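import Mathlib
import Literature.Analysis.FluidPDE.VectorCalculus
import Literature.Analysis.FluidPDE.TaoAveragedNondegeneracy
import Literature.Analysis.FluidPDE.DifferentiableGaussGreen
import Literature.Analysis.FluidPDE.LeiZhang2011Proofs

/-!
# Tilt algebra for the endgame of line `zero-accretion-selection` (tools stub `stub_tameVerticalToolsA`)

Tools for the subcriticality estimate `stub_tameVerticalSubcritical` (crux `SkeletonEquilibrium`, thesis
`FilamentSkeletonRss`; lead a1). Pointwise facts used on strands OTHER than the one through the stagnation
point: the triple-product swap `⟪T × r, T₀⟫ = −⟪T × T₀, r⟫`; the relative tilt of two near-vertical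
unit vectors, `‖a × b‖ ≤ 2θ + θ²` from `‖a × e‖, ‖b × e‖ ≤ θ` (any orientations); and the AXIAL KERNEL
DERIVATIVE BOUND `|−3((‖r‖²+1)^(5/2))⁻¹⟪r,T₀⟫⟪T × r,T₀⟫| ≤ 3‖T × T₀‖((‖r‖²+1)^(3/2))⁻¹` — one factor
of the relative tilt and integrable decay, the integrand of the landed `stub_slopeFormula` (p165350).
-/

noncomputable section

open Literature.Analysis.FluidPDE Literature.Analysis.FluidPDE.Tao2016
open scoped RealInnerProductSpace InnerProductSpace

namespace Summit.NavierStokesRegularity.NavierStokesRegularity.Theorems.SkeletonEquilibrium.ZeroAccretionSelection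
set_option linter.dupNamespace false

/-- `|⟪T × r, T₀⟫| ≤ ‖T × T₀‖ ‖r‖`. [folklore] -/
theorem abs_inner_cross_le (T r T₀ : EuclideanSpace ℝ (Fin 3)) :
    |⟪cross T r, T₀⟫| ≤ ‖cross T T₀‖ * ‖r‖ := by
  rw [inner_cross_left_swap, abs_neg]
  exact abs_real_inner_le_norm _ _

/-- Lagrange: for a UNIT vector `e`, `‖a − ⟪a,e⟫e‖ = ‖a × e‖` (the horizontal part has the norm of the
cross product). [folklore] -/
theorem norm_sub_proj_eq_norm_cross (a e : EuclideanSpace ℝ (Fin 3)) (he : ‖e‖ = 1) :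
    ‖a - ⟪a, e⟫ • e‖ = ‖cross a e‖ := by
  have h1 : ‖a - ⟪a, e⟫ • e‖ ^ 2 = ‖a‖ ^ 2 - ⟪a, e⟫ ^ 2 := by
    rw [← real_inner_self_eq_norm_sq, inner_sub_left, inner_sub_right, inner_sub_right,
      real_inner_smul_left, real_inner_smul_right, real_inner_smul_left, real_inner_smul_right,
      real_inner_self_eq_norm_sq, real_inner_self_eq_norm_sq, he, real_inner_comm e a]
    ring
  have h2 : ‖cross a e‖ ^ 2 = ‖a‖ ^ 2 - ⟪a, e⟫ ^ 2 := by
    rw [norm_cross_sq, he]; ring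
  have h3 : ‖a - ⟪a, e⟫ • e‖ ^ 2 = ‖cross a e‖ ^ 2 := by rw [h1, h2]
  exact (pow_left_inj₀ (norm_nonneg _) (norm_nonneg _) two_ne_zero).1 h3

/-- **Relative tilt of two near-vertical unit vectors.** If `‖a × e‖ ≤ θ` and `‖b × e‖ ≤ θ` for a unit
`e` and unit `a, b`, then `‖a × b‖ ≤ 2θ + θ²` (so `≤ 3θ` for `θ ≤ 1`), irrespective of whether `a, b`
point up or down. [folklore] -/
theorem norm_cross_le_of_near_axis (a b e : EuclideanSpace ℝ (Fin 3)) (ha : ‖a‖ = 1) (hb : ‖b‖ = 1)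
    (he : ‖e‖ = 1) {θ : ℝ} (hae : ‖cross a e‖ ≤ θ) (hbe : ‖cross b e‖ ≤ θ) :
    ‖cross a b‖ ≤ 2 * θ + θ ^ 2 := by
  -- decompose a = ⟪a,e⟫e + a', b = ⟪b,e⟫e + b'
  set a' := a - ⟪a, e⟫ • e with ha'
  set b' := b - ⟪b, e⟫ • e with hb'
  have hna' : ‖a'‖ ≤ θ := by rw [ha', norm_sub_proj_eq_norm_cross a e he]; exact hae
  have hnb' : ‖b'‖ ≤ θ := by rw [hb', norm_sub_proj_eq_norm_cross b e he]; exact hbe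
  have hθ : 0 ≤ θ := le_trans (norm_nonneg _) hae
  have hca : |⟪a, e⟫| ≤ 1 := by
    have := abs_real_inner_le_norm a e; rw [ha, he, one_mul] at this; exact this
  have hcb : |⟪b, e⟫| ≤ 1 := by
    have := abs_real_inner_le_norm b e; rw [hb, he, one_mul] at this; exact this
  have hdec : cross a b = ⟪a, e⟫ • cross e b' + ⟪b, e⟫ • cross a' e + cross a' b' := by
    rw [ha', hb']
    ext i
    fin_cases i <;> simp [cross_apply_zero, cross_apply_one, cross_apply_two] <;> ring
  calc ‖cross a b‖ = ‖⟪a, e⟫ • cross e b' + ⟪b, e⟫ • cross a' e + cross a' b'‖ := by rw [hdec]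
    _ ≤ ‖⟪a, e⟫ • cross e b'‖ + ‖⟪b, e⟫ • cross a' e‖ + ‖cross a' b'‖ := norm_add₃_le
    _ ≤ 1 * (1 * θ) + 1 * (θ * 1) + θ * θ := by
        gcongr
        · rw [norm_smul, Real.norm_eq_abs]
          exact mul_le_mul hca (le_trans (norm_cross_le_norm_mul_norm e b') (by rw [he]; gcongr)) (norm_nonneg _) zero_le_one
        · rw [norm_smul, Real.norm_eq_abs]
          exact mul_le_mul hcb (le_trans (norm_cross_le_norm_mul_norm a' e) (by rw [he]; gcongr)) (norm_nonneg _) zero_le_one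
        · exact le_trans (norm_cross_le_norm_mul_norm a' b') (mul_le_mul hna' hnb' (norm_nonneg _) hθ)
    _ = 2 * θ + θ ^ 2 := by ring

/-- **Axial kernel derivative of a tilted element.** For any `r, T, T₀` with `‖T₀‖ ≤ 1`:
`|−3((‖r‖²+1)^(5/2))⁻¹ ⟪r, T₀⟫ ⟪T × r, T₀⟫| ≤ 3 ‖T × T₀‖ ((‖r‖²+1)^(3/2))⁻¹`. [folklore] -/
theorem abs_axial_kernel_deriv_le (r T T₀ : EuclideanSpace ℝ (Fin 3)) (hT₀ : ‖T₀‖ ≤ 1) :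
    |(-3) * ((‖r‖ ^ 2 + 1) ^ (5 / 2 : ℝ))⁻¹ * ⟪r, T₀⟫ * ⟪cross T r, T₀⟫| ≤
      3 * ‖cross T T₀‖ * ((‖r‖ ^ 2 + 1) ^ (3 / 2 : ℝ))⁻¹ := by
  have hq : 0 < ‖r‖ ^ 2 + 1 := by positivity
  have h52 : (‖r‖ ^ 2 + 1) ^ (5 / 2 : ℝ) = (‖r‖ ^ 2 + 1) ^ (3 / 2 : ℝ) * (‖r‖ ^ 2 + 1) := by
    rw [show (5 / 2 : ℝ) = 3 / 2 + 1 by norm_num, Real.rpow_add hq, Real.rpow_one]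
  have hp32 : 0 < (‖r‖ ^ 2 + 1) ^ (3 / 2 : ℝ) := Real.rpow_pos_of_pos hq _
  have h1 : |⟪r, T₀⟫| ≤ ‖r‖ := by
    have := abs_real_inner_le_norm r T₀
    calc |⟪r, T₀⟫| ≤ ‖r‖ * ‖T₀‖ := this
      _ ≤ ‖r‖ * 1 := by gcongr
      _ = ‖r‖ := mul_one _
  have h2 : |⟪cross T r, T₀⟫| ≤ ‖cross T T₀‖ * ‖r‖ := abs_inner_cross_le T r T₀
  rw [abs_mul, abs_mul, abs_mul, abs_inv, abs_of_pos (Real.rpow_pos_of_pos hq _),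
    show |(-3 : ℝ)| = 3 by norm_num, h52, mul_inv]
  have h3 : |⟪r, T₀⟫| * |⟪cross T r, T₀⟫| ≤ ‖r‖ * (‖cross T T₀‖ * ‖r‖) :=
    mul_le_mul h1 h2 (abs_nonneg _) (norm_nonneg _)
  have h4 : ‖r‖ * (‖cross T T₀‖ * ‖r‖) * (‖r‖ ^ 2 + 1)⁻¹ ≤ ‖cross T T₀‖ := by
    rw [mul_inv_le_iff₀ hq]
    nlinarith [norm_nonneg (cross T T₀), sq_nonneg ‖r‖]
  calc 3 * (((‖r‖ ^ 2 + 1) ^ (3 / 2 : ℝ))⁻¹ * (‖r‖ ^ 2 + 1)⁻¹) * |⟪r, T₀⟫| * |⟪cross T r, T₀⟫|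
      = 3 * ((‖r‖ ^ 2 + 1) ^ (3 / 2 : ℝ))⁻¹ * ((|⟪r, T₀⟫| * |⟪cross T r, T₀⟫|) * (‖r‖ ^ 2 + 1)⁻¹) := by
        ring
    _ ≤ 3 * ((‖r‖ ^ 2 + 1) ^ (3 / 2 : ℝ))⁻¹ * ((‖r‖ * (‖cross T T₀‖ * ‖r‖)) * (‖r‖ ^ 2 + 1)⁻¹) := by
        gcongr
    _ ≤ 3 * ((‖r‖ ^ 2 + 1) ^ (3 / 2 : ℝ))⁻¹ * ‖cross T T₀‖ := by
        gcongr
    _ = 3 * ‖cross T T₀‖ * ((‖r‖ ^ 2 + 1) ^ (3 / 2 : ℝ))⁻¹ := by ring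


/-- **Registered tools stub `stub_tameVerticalToolsA`** (line `zero-accretion-selection`): the conjunction of
`norm_cross_le_of_near_axis`, `abs_axial_kernel_deriv_le`, and the tree's `inner_cross_left_swap`. [folklore] -/
theorem stub_tameVerticalToolsA :
    (∀ (a b e : EuclideanSpace ℝ (Fin 3)) (θ : ℝ), ‖a‖ = 1 → ‖b‖ = 1 → ‖e‖ = 1 →
      ‖cross a e‖ ≤ θ → ‖cross b e‖ ≤ θ → ‖cross a b‖ ≤ 2 * θ + θ ^ 2) ∧
    (∀ (r T T₀ : EuclideanSpace ℝ (Fin 3)), ‖T₀‖ ≤ 1 →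
      |(-3) * ((‖r‖ ^ 2 + 1) ^ (5 / 2 : ℝ))⁻¹ * ⟪r, T₀⟫ * ⟪cross T r, T₀⟫| ≤
        3 * ‖cross T T₀‖ * ((‖r‖ ^ 2 + 1) ^ (3 / 2 : ℝ))⁻¹) ∧
    (∀ (T r T₀ : EuclideanSpace ℝ (Fin 3)), ⟪cross T r, T₀⟫ = -⟪cross T T₀, r⟫) :=
  ⟨fun a b e _ ha hb he hae hbe => norm_cross_le_of_near_axis a b e ha hb he hae hbe,
    fun r T T₀ hT₀ => abs_axial_kernel_deriv_le r T T₀ hT₀, inner_cross_left_swap⟩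

end Summit.NavierStokesRegularity.NavierStokesRegularity.Theorems.SkeletonEquilibrium.ZeroAccretionSelection
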